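import Summits.QuantumFields.YangMills.Theorems.UnitScaleTiltProp8HalvingDressingLetterChartOfRecordWindow
import Summits.QuantumFields.YangMills.Theorems.UnitScaleTiltProp8ChartKernelFlatColumn
import HarnessLib

/-!
# Route `UnitScaleTilt`, crux K1 child «MinimiserStabilityRegPr» (stmt-QuantumFields-19200), registered stub V2′ `stub_halvingStep` (skeleton v10 `BirthV10`) —
# **THE DRESSING LETTER `C_E` ON THE CHART OF RECORD WITH ITS LAST DISPLAYED INPUT DISCHARGED (FILE E v3 = FILE E v2 ∘ (S4′))**: ★w6-19200 s2's ✓ p618497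
# `exists_hWq_dressed_cubeSeq_T3_chartOfRecord_ofKernelRow` read its (X2-C′)♭ column from ONE displayed input — the (157)♭ READ-bond kernel row `hKball` of the double-bar chart
# on an `R′`-ball at slope `C₃`; ✓ p617942 `ChartKernelFlat.kernel157_flat_ball` ([Balaban1985Averaging] Prop. 5 (157) for `chartLogFlat`, (S4′)) IS that row with
# `C₃ := 9830400000·L⁴`, `R′ := (29491200000·L⁴)⁻¹`.  Here the two are composed: the C_E node of line H has NO displayed input left.

Cell `ym3-torus` (HUMAN RULING D-0037: YM₃ on the torus is ladder rung R3, not the Clay problem), width seat `ym-ust-19936-w5` gen 3; `--supports stmt-QuantumFields-19200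
--as helper`; def-free, 0 sorry.

WHAT.  ★★★ `exists_hWq_dressed_cubeSeq_T3_chartOfRecord_closed (ℓ) (hL) (hℓ : 4 ≤ ℓ)` — FILE E v2's statement VERBATIM with the `∀ C₃ R′ …` prefix and the `hKball` binder
REMOVED and `C₃ ↦ 9830400000·(ℓ+1)⁴`, `R′ ↦ (29491200000·(ℓ+1)⁴)⁻¹` substituted: member-uniform `Mh₀ R₀ B_H C_X K₀ C_P ε R_c⁰ a₃` (from `L = ℓ + 1` alone) with FILE E's seven
window rows, and at every member∕height∕admissible cube sequence∕weights of record the full output `∃ Hs Dsel W₀, …` (display of `Hs`, `hHinv`, (46) rows, `Dsel` analytic with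
(55)∕(49)∕(48)∕uniqueness∕eventual formula∕differentiabilities∕(X2-D)♭, `W₀` = plaquette gradient, and the `w 3`-row (iii) of the (165) pairing for `W := W₀(Y − Hs(Dsel Y)) + E Y`).
PROOF.  `R′(L) ≤ R_s∕4` is `6080000·L³·4 ≤ 29491200000·L⁴`·(numerals); FILE E v2 at (`C₃`, `R′`); my `R₀ := max R₀ᴱ 2` so that `2L ≤ R·((ℓ+1)·Mh) + 1`; `hKball :=
kernel157_flat_ball F n K (cubeSeqMT3 …) (cubeSeqMT3_k …) (adm22_cubeSeqMT3 … hRS) hRM hw`.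
HONEST SCOPE.  A composition; the mathematics is in ✓p618497 (and its FILE A–E chain) and ✓p617042∕p617942 (and the (S4′) chain).  The downstream S16 seam, the P1♭ pillar,
the D-P1 clause and the (P2) branches of RULING g26-№16 are NOT touched.  NOT a claim about the stub, the crux, the rung or the mass gap; no summit statement is proved here.

References: T. Bałaban, CMP **102** (1985) 277–309 [Balaban1985Variational] ((44)–(50) p.285, (55) p.286, (72)–(73) p.289, (80)–(89) pp.290–291, Prop. 4 (97)–(98)
pp.292–293, (152)–(158) pp.301–302, (161)–(163) p.303); CMP **98** (1985) 17–51 [Balaban1985Averaging] (Prop. 5 (156)–(157) p.42).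
-/

set_option autoImplicit false

noncomputable section

open scoped BigOperators Matrix Matrix.Norms.L2Operator
open NormedSpace Filter Topology

namespace Summit.QuantumFields.YangMills.Theorems.HalvingDressingLetter

open Literature.MathematicalPhysics.QuantumFieldTheory.Balaban1983to89
open B6GlobalChartV1 (PV)
open B6SectADomainsV1 (Domains)
open B6SectAOperatorsV1 (BondIdx)
open B5Eq118OneStroke (iterBlockOf)
open T3ContinuumYM3Torus (T3Family)
open FlatCubeOpsText (Adm22 IsLevWeight)
open FlatOpsLettersAssembly (flatH)
open FlatCubeSequenceAligned (cubeSeqMT3 cubeSeqMT3_k)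
open FlatCubeSequenceAdm (adm22_cubeSeqMT3)
open Prop8ChartDoubleBar (chartLogFlat)
open ChartKernelFlat (kernel157_flat_ball)

/-- `1 ≤ 3`, the centre index proof fed to `PV 2 ℓ m K · hL` (any proof will do, by proof irrelevance). [folklore] -/
private theorem hd3 : 1 ≤ 2 + 1 := by norm_num

/-- The radius of the (157)♭ kernel row, `R′(L) = (29491200000·L⁴)⁻¹`, lies inside the quarter chart ball `R_s∕4 = (16·3800·(5L)²·L)⁻¹∕4`. [folklore] -/
theorem radFlat_le_quarter_Rs (ℓ : ℕ) :
    (29491200000 * ((ℓ + 1 : ℕ) : ℝ) ^ 4)⁻¹ ≤ (16 * 3800 * ((((2 + 1 + 2) * (ℓ + 1) : ℕ)) : ℝ) ^ 2 * ((ℓ + 1 : ℕ) : ℝ))⁻¹ / 4 := by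
  have hL0 : (0 : ℝ) < ((ℓ + 1 : ℕ) : ℝ) := by positivity
  have hL1 : (1 : ℝ) ≤ ((ℓ + 1 : ℕ) : ℝ) := by exact_mod_cast Nat.succ_le_succ (Nat.zero_le ℓ)
  have hcast : ((((2 + 1 + 2) * (ℓ + 1) : ℕ)) : ℝ) = 5 * ((ℓ + 1 : ℕ) : ℝ) := by push_cast; ring
  rw [hcast, div_eq_mul_inv, ← mul_inv]
  apply inv_anti₀ (by positivity)
  have h34 : ((ℓ + 1 : ℕ) : ℝ) ^ 3 ≤ ((ℓ + 1 : ℕ) : ℝ) ^ 4 := pow_le_pow_right₀ hL1 (by norm_num)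
  have h4 : (0 : ℝ) ≤ ((ℓ + 1 : ℕ) : ℝ) ^ 4 := by positivity
  calc 16 * 3800 * (5 * ((ℓ + 1 : ℕ) : ℝ)) ^ 2 * ((ℓ + 1 : ℕ) : ℝ) * 4 = 6080000 * ((ℓ + 1 : ℕ) : ℝ) ^ 3 := by ring
    _ ≤ 6080000 * ((ℓ + 1 : ℕ) : ℝ) ^ 4 := by linarith
    _ ≤ 29491200000 * ((ℓ + 1 : ℕ) : ℝ) ^ 4 := by linarith

/-- ★★★ **THE DRESSING LETTER `C_E` ON THE CHART OF RECORD, NO DISPLAYED INPUT LEFT (FILE E v3)** — ✓`exists_hWq_dressed_cubeSeq_T3_chartOfRecord_ofKernelRow` (FILE E v2) with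
its (157)♭ READ-bond kernel row supplied by ✓`ChartKernelFlat.kernel157_flat_ball` ((S4′): [Balaban1985Averaging] Prop. 5 (157) for the double-bar chart `chartLogFlat`) at
`C₃ := 9830400000·(ℓ+1)⁴`, `R′ := (29491200000·(ℓ+1)⁴)⁻¹`: for every `L = ℓ + 1 ≥ 5` (odd) there are `Mh₀ R₀ B_H C_X K₀ C_P` and `ε R_c⁰ a₃` (all from `L` alone) with FILE E's
seven window rows such that at every member∕height∕admissible cube sequence and the weights of record the full FILE E output holds (`Hs`, `Dsel`, `W₀` with all their
displayed rows, and the `w 3`-row (iii) of the (165) pairing). [cite: Balaban1985Variational, (44)-(50) p.285, (55) p.286, (72)-(73) p.289, (80)-(89) pp.290-291, Prop. 4 (97)-(98) pp.292-293, (152)-(158) pp.301-302, (161)-(163) p.303; Balaban1985Averaging, Prop. 5 (157) p.42] -/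
theorem exists_hWq_dressed_cubeSeq_T3_chartOfRecord_closed (ℓ : ℕ) (hL : Odd (ℓ + 1) ∧ 1 < ℓ + 1) (hℓ : 4 ≤ ℓ) :
    ∃ (Mh₀ R₀ : ℕ) (BH CX K₀ CP : ℝ), 0 ≤ BH ∧ 0 ≤ CX ∧ 0 ≤ K₀ ∧ 0 ≤ CP ∧
    ∃ (ε Rc₀ a₃ : ℝ), 0 < a₃ ∧ a₃ ≤ Rc₀ ∧ Rc₀ < ε ∧
      3 * ε ≤ (16 * 3800 * ((((2 + 1 + 2) * (ℓ + 1) : ℕ)) : ℝ) ^ 2 * ((ℓ + 1 : ℕ) : ℝ))⁻¹ / 4 ∧ 9 * (64 * ((ℓ + 1 : ℕ) : ℝ) / (16 * 3800 * ((((2 + 1 + 2) * (ℓ + 1) : ℕ)) : ℝ) ^ 2 * ((ℓ + 1 : ℕ) : ℝ))⁻¹) * BH * ε < 1 ∧ (1 + 4 * BH * (64 * ((ℓ + 1 : ℕ) : ℝ) / (16 * 3800 * ((((2 + 1 + 2) * (ℓ + 1) : ℕ)) : ℝ) ^ 2 * ((ℓ + 1 : ℕ) : ℝ))⁻¹) *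 ε) * ε ≤ (29491200000 * ((ℓ + 1 : ℕ) : ℝ) ^ 4)⁻¹ ∧
      (1 + 4 * BH * (64 * ((ℓ + 1 : ℕ) : ℝ) / (16 * 3800 * ((((2 + 1 + 2) * (ℓ + 1) : ℕ)) : ℝ) ^ 2 * ((ℓ + 1 : ℕ) : ℝ))⁻¹) * Rc₀) * a₃ ≤ 1 / (2 * ((ℓ + 1 : ℕ) : ℝ)) ∧
    ∀ (m : ℕ) (hm : 1 ≤ m) (n K : ℕ) (_ : 1 ≤ K - n) (_ : K - n + 1 ≤ m + K) {Mh R a' : ℕ} (_ : Mh = (ℓ + 1) ^ a') (_ : Mh₀ ≤ Mh) (_ : R₀ ≤ R)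
      (_ : a' + 3 ≤ m + n) (x₀ : Site (PV 2 ℓ m K hd3 hL) 0) (ρ S : ℕ) (hM : 1 ≤ (ℓ + 1) * Mh) (_ : R * ((ℓ + 1) * Mh) ≤ S)
      (w : ℕ → PBond (PV 2 ℓ m K hd3 hL) 0 → ℝ) (_ : IsLevWeight (⟨ℓ + 1, hL, m, hm⟩ : T3Family) n K (cubeSeqMT3 (⟨ℓ + 1, hL, m, hm⟩ : T3Family) n K x₀ ρ S ((ℓ + 1) * Mh) hM) w),
    ∃ (Hs : (BondIdx (cubeSeqMT3 (⟨ℓ + 1, hL, m, hm⟩ : T3Family) n K x₀ ρ S ((ℓ + 1) * Mh) hM) → Matrix (Fin 2) (Fin 2) ℂ) →ₗ[ℂ] (PBond (PV 2 ℓ m K hd3 hL) 0 → Matrix (Fin 2) (Fin 2) ℂ))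
      (Dsel : (PBond (PV 2 ℓ m K hd3 hL) 0 → Matrix (Fin 2) (Fin 2) ℂ) → BondIdx (cubeSeqMT3 (⟨ℓ + 1, hL, m, hm⟩ : T3Family) n K x₀ ρ S ((ℓ + 1) * Mh) hM) → Matrix (Fin 2) (Fin 2) ℂ)
      (W₀ : (PBond (PV 2 ℓ m K hd3 hL) 0 → Matrix (Fin 2) (Fin 2) ℂ) → (PBond (PV 2 ℓ m K hd3 hL) 0 → Matrix (Fin 2) (Fin 2) ℂ)),
      (∀ (X : BondIdx (cubeSeqMT3 (⟨ℓ + 1, hL, m, hm⟩ : T3Family) n K x₀ ρ S ((ℓ + 1) * Mh) hM) → Matrix (Fin 2) (Fin 2) ℂ) (b : PBond (PV 2 ℓ m K hd3 hL) 0),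
        Hs X b = ∑ c : BondIdx (cubeSeqMT3 (⟨ℓ + 1, hL, m, hm⟩ : T3Family) n K x₀ ρ S ((ℓ + 1) * Mh) hM), (flatH (⟨ℓ + 1, hL, m, hm⟩ : T3Family) n K (cubeSeqMT3 (⟨ℓ + 1, hL, m, hm⟩ : T3Family) n K x₀ ρ S ((ℓ + 1) * Mh) hM) (Pi.single c 1) b * ((((ℓ + 1 : ℕ) : ℝ)) ^ (c.1.1 : ℕ) * ((((ℓ + 1 : ℕ) : ℝ))⁻¹) ^ (K - n))⁻¹) • X c) ∧
      (∀ X : BondIdx (cubeSeqMT3 (⟨ℓ + 1, hL, m, hm⟩ : T3Family) n K x₀ ρ S ((ℓ + 1) * Mh) hM) → Matrix (Fin 2) (Fin 2) ℂ, (fderiv ℂ (chartLogFlat (((((ℓ + 1 : ℕ) : ℝ))⁻¹) ^ (K - n)) (cubeSeqMT3 (⟨ℓ + 1, hL, m, hm⟩ : T3Family) n K x₀ ρ S ((ℓ + 1) * Mh) hM) : (PBond (PV 2 ℓ m K hd3 hL) 0 → Matrix (Fin 2) (Fin 2) ℂ) → BondIdx (cubeSeqMT3 (⟨ℓ + 1,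 hL, m, hm⟩ : T3Family) n K x₀ ρ S ((ℓ + 1) * Mh) hM) → Matrix (Fin 2) (Fin 2) ℂ) 0) (Hs X) = X) ∧
      (∀ (X : BondIdx (cubeSeqMT3 (⟨ℓ + 1, hL, m, hm⟩ : T3Family) n K x₀ ρ S ((ℓ + 1) * Mh) hM) → Matrix (Fin 2) (Fin 2) ℂ) (t : ℝ), (∀ c, ‖X c‖ ≤ t) →
        (∀ b, w 1 b * ‖Hs X b‖ ≤ BH * t) ∧
        ∀ (b : PBond (PV 2 ℓ m K hd3 hL) 0) (ν : Fin 3), w 2 b * ((ℓ + 1 : ℕ) : ℝ) ^ (K - n) * ‖Hs X ⟨b.src.shift ν, b.dir⟩ - Hs X b‖ ≤ BH * t) ∧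
      AnalyticOnNhd ℂ Dsel {A' : PBond (PV 2 ℓ m K hd3 hL) 0 → Matrix (Fin 2) (Fin 2) ℂ | ∀ b, w 1 b * ‖A' b‖ < ε} ∧
      DifferentiableOn ℂ (fderiv ℂ Dsel) {A' : PBond (PV 2 ℓ m K hd3 hL) 0 → Matrix (Fin 2) (Fin 2) ℂ | ∀ b, w 1 b * ‖A' b‖ < ε} ∧
      (∀ A' : PBond (PV 2 ℓ m K hd3 hL) 0 → Matrix (Fin 2) (Fin 2) ℂ, (∀ b, w 1 b * ‖A' b‖ < ε) →
        (∀ c, ‖Dsel A' c‖ ≤ 4 * (64 * ((ℓ + 1 : ℕ) : ℝ) / (16 * 3800 * (((((PV 2 ℓ m K hd3 hL)).d + 2) * ((PV 2 ℓ m K hd3 hL)).L : ℕ) : ℝ) ^ 2 * ((ℓ + 1 : ℕ) : ℝ))⁻¹) * ε ^ 2) ∧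
        chartLogFlat (((((ℓ + 1 : ℕ) : ℝ))⁻¹) ^ (K - n)) (cubeSeqMT3 (⟨ℓ + 1, hL, m, hm⟩ : T3Family) n K x₀ ρ S ((ℓ + 1) * Mh) hM) (A' - Hs (Dsel A')) - (fderiv ℂ (chartLogFlat (((((ℓ + 1 : ℕ) : ℝ))⁻¹) ^ (K - n)) (cubeSeqMT3 (⟨ℓ + 1, hL, m, hm⟩ : T3Family) n K x₀ ρ S ((ℓ + 1) * Mh) hM) : (PBond (PV 2 ℓ m K hd3 hL) 0 → Matrix (Fin 2) (Fin 2) ℂ) → BondIdx (cubeSeqMT3 (⟨ℓ + 1, hL, m, hm⟩ : T3Family) n K x₀ ρ S ((ℓ + 1) * Mh) hM) → Matrix (Fin 2) (Fin 2) ℂ) 0) (A' - Hs (Dsel A')) = Dsel A' ∧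
        chartLogFlat (((((ℓ + 1 : ℕ) : ℝ))⁻¹) ^ (K - n)) (cubeSeqMT3 (⟨ℓ + 1, hL, m, hm⟩ : T3Family) n K x₀ ρ S ((ℓ + 1) * Mh) hM) (A' - Hs (Dsel A')) = (fderiv ℂ (chartLogFlat (((((ℓ + 1 : ℕ) : ℝ))⁻¹) ^ (K - n)) (cubeSeqMT3 (⟨ℓ + 1, hL, m, hm⟩ : T3Family) n K x₀ ρ S ((ℓ + 1) * Mh) hM) : (PBond (PV 2 ℓ m K hd3 hL) 0 → Matrix (Fin 2) (Fin 2) ℂ) → BondIdx (cubeSeqMT3 (⟨ℓ + 1, hL, m, hm⟩ : T3Family) n K x₀ ρ S ((ℓ + 1) * Mh) hM) → Matrix (Fin 2) (Fin 2) ℂ) 0) A' ∧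
        (∀ D' : BondIdx (cubeSeqMT3 (⟨ℓ + 1, hL, m, hm⟩ : T3Family) n K x₀ ρ S ((ℓ + 1) * Mh) hM) → Matrix (Fin 2) (Fin 2) ℂ, (∀ c, ‖D' c‖ ≤ 4 * (64 * ((ℓ + 1 : ℕ) : ℝ) / (16 * 3800 * (((((PV 2 ℓ m K hd3 hL)).d + 2) * ((PV 2 ℓ m K hd3 hL)).L : ℕ) : ℝ) ^ 2 * ((ℓ + 1 : ℕ) : ℝ))⁻¹) * ε ^ 2) →
          chartLogFlat (((((ℓ + 1 : ℕ) : ℝ))⁻¹) ^ (K - n)) (cubeSeqMT3 (⟨ℓ + 1, hL, m, hm⟩ : T3Family) n K x₀ ρ S ((ℓ + 1) * Mh) hM) (A' - Hs D') - (fderiv ℂ (chartLogFlat (((((ℓ + 1 : ℕ) : ℝ))⁻¹) ^ (K - n)) (cubeSeqMT3 (⟨ℓ + 1, hL, m, hm⟩ : T3Family) n K x₀ ρ S ((ℓ + 1) * Mh) hM) : (PBond (PV 2 ℓ m K hd3 hL) 0 → Matrix (Fin 2) (Fin 2) ℂ) → BondIdx (cubeSeqMT3 (⟨ℓ + 1,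 hL, m, hm⟩ : T3Family) n K x₀ ρ S ((ℓ + 1) * Mh) hM) → Matrix (Fin 2) (Fin 2) ℂ) 0) (A' - Hs D') = D' → D' = Dsel A') ∧
        (∀ ρ' : ℝ, 0 ≤ ρ' → (∀ b, w 1 b * ‖A' b‖ ≤ ρ') → ∀ c, ‖Dsel A' c‖ ≤ 4 * (64 * ((ℓ + 1 : ℕ) : ℝ) / (16 * 3800 * (((((PV 2 ℓ m K hd3 hL)).d + 2) * ((PV 2 ℓ m K hd3 hL)).L : ℕ) : ℝ) ^ 2 * ((ℓ + 1 : ℕ) : ℝ))⁻¹) * ρ' ^ 2)) ∧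
      (∀ (Y : PBond (PV 2 ℓ m K hd3 hL) 0 → Matrix (Fin 2) (Fin 2) ℂ) (r : ℝ), r < ε → (∀ b, w 1 b * ‖Y b‖ ≤ r) → (∀ (b : PBond (PV 2 ℓ m K hd3 hL) 0) (ν : Fin 3), w 2 b * ((ℓ + 1 : ℕ) : ℝ) ^ (K - n) * ‖Y ⟨b.src.shift ν, b.dir⟩ - Y b‖ ≤ r) →
        ∀ c, ‖Dsel Y c‖ ≤ 4 * (64 * ((ℓ + 1 : ℕ) : ℝ) / (16 * 3800 * (((((PV 2 ℓ m K hd3 hL)).d + 2) * ((PV 2 ℓ m K hd3 hL)).L : ℕ) : ℝ) ^ 2 * ((ℓ + 1 : ℕ) : ℝ))⁻¹) * r ^ 2) ∧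
      (∀ (Y : PBond (PV 2 ℓ m K hd3 hL) 0 → Matrix (Fin 2) (Fin 2) ℂ) (r : ℝ), r < ε → (∀ b, w 1 b * ‖Y b‖ ≤ r) → (∀ (b : PBond (PV 2 ℓ m K hd3 hL) 0) (ν : Fin 3), w 2 b * ((ℓ + 1 : ℕ) : ℝ) ^ (K - n) * ‖Y ⟨b.src.shift ν, b.dir⟩ - Y b‖ ≤ r) →
        ∀ᶠ X in 𝓝 Y, Dsel X = (fun Z : PBond (PV 2 ℓ m K hd3 hL) 0 → Matrix (Fin 2) (Fin 2) ℂ => chartLogFlat (((((ℓ + 1 : ℕ) : ℝ))⁻¹) ^ (K - n)) (cubeSeqMT3 (⟨ℓ + 1, hL, m, hm⟩ : T3Family) n K x₀ ρ S ((ℓ + 1) * Mh) hM) Z - fderiv ℂ (chartLogFlat (((((ℓ + 1 : ℕ) : ℝ))⁻¹) ^ (K - n)) (cubeSeqMT3 (⟨ℓ + 1, hL, m, hm⟩ : T3Family) n K x₀ ρ S ((ℓ + 1) * Mh) hM) : (PBond (PV 2 ℓ m K hd3 hL) 0 → Matrix (Fin 2) (Fin 2) ℂ) → BondIdx (cubeSeqMT3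 (⟨ℓ + 1, hL, m, hm⟩ : T3Family) n K x₀ ρ S ((ℓ + 1) * Mh) hM) → Matrix (Fin 2) (Fin 2) ℂ) 0 Z) (X - Hs (Dsel X))) ∧
      (∀ (Y : PBond (PV 2 ℓ m K hd3 hL) 0 → Matrix (Fin 2) (Fin 2) ℂ) (r : ℝ), r < ε → (∀ b, w 1 b * ‖Y b‖ ≤ r) → (∀ (b : PBond (PV 2 ℓ m K hd3 hL) 0) (ν : Fin 3), w 2 b * ((ℓ + 1 : ℕ) : ℝ) ^ (K - n) * ‖Y ⟨b.src.shift ν, b.dir⟩ - Y b‖ ≤ r) →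
        DifferentiableAt ℂ Dsel Y) ∧
      (∀ (Y : PBond (PV 2 ℓ m K hd3 hL) 0 → Matrix (Fin 2) (Fin 2) ℂ) (r : ℝ), r < ε → (∀ b, w 1 b * ‖Y b‖ ≤ r) → (∀ (b : PBond (PV 2 ℓ m K hd3 hL) 0) (ν : Fin 3), w 2 b * ((ℓ + 1 : ℕ) : ℝ) ^ (K - n) * ‖Y ⟨b.src.shift ν, b.dir⟩ - Y b‖ ≤ r) →
        DifferentiableAt ℂ (fun Z : PBond (PV 2 ℓ m K hd3 hL) 0 → Matrix (Fin 2) (Fin 2) ℂ => chartLogFlat (((((ℓ + 1 : ℕ) : ℝ))⁻¹) ^ (K - n)) (cubeSeqMT3 (⟨ℓ + 1, hL, m, hm⟩ : T3Family) n K x₀ ρ S ((ℓ + 1) * Mh) hM) Z - fderiv ℂ (chartLogFlat (((((ℓ + 1 : ℕ) : ℝ))⁻¹) ^ (K - n)) (cubeSeqMT3 (⟨ℓ + 1, hL, m, hm⟩ : T3Family) n K x₀ ρ S ((ℓ + 1) * Mh) hM) : (PBond (PV 2 ℓ m K hd3 hL) 0 → Matrix (Fin 2) (Fin 2) ℂ)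 → BondIdx (cubeSeqMT3 (⟨ℓ + 1, hL, m, hm⟩ : T3Family) n K x₀ ρ S ((ℓ + 1) * Mh) hM) → Matrix (Fin 2) (Fin 2) ℂ) 0 Z) (Y - Hs (Dsel Y))) ∧
      (∀ A' : PBond (PV 2 ℓ m K hd3 hL) 0 → Matrix (Fin 2) (Fin 2) ℂ, (∀ b, w 1 b * ‖A' b‖ < ε) → ∀ ρ' : ℝ, 0 ≤ ρ' → (∀ b, w 1 b * ‖A' b‖ ≤ ρ') →
        ∀ (W : PBond (PV 2 ℓ m K hd3 hL) 0 → Matrix (Fin 2) (Fin 2) ℂ) (t : ℝ), 0 ≤ t → (∀ b, w 1 b * ‖W b‖ ≤ t) →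
          ∀ c, ‖fderiv ℂ Dsel A' W c‖ ≤ 9 * (64 * ((ℓ + 1 : ℕ) : ℝ) / (16 * 3800 * (((((PV 2 ℓ m K hd3 hL)).d + 2) * ((PV 2 ℓ m K hd3 hL)).L : ℕ) : ℝ) ^ 2 * ((ℓ + 1 : ℕ) : ℝ))⁻¹) * ρ' * (1 - 9 * (64 * ((ℓ + 1 : ℕ) : ℝ) / (16 * 3800 * (((((PV 2 ℓ m K hd3 hL)).d + 2) * ((PV 2 ℓ m K hd3 hL)).L : ℕ) : ℝ) ^ 2 * ((ℓ + 1 : ℕ) : ℝ))⁻¹) * BH * ε)⁻¹ * t) ∧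
      (∀ A δ : PBond (PV 2 ℓ m K hd3 hL) 0 → Matrix (Fin 2) (Fin 2) ℂ, fderiv ℂ (fun A : PBond (PV 2 ℓ m K hd3 hL) 0 → Matrix (Fin 2) (Fin 2) ℂ => (∑ p : Plaq (PV 2 ℓ m K hd3 hL) 0, (1 - (2 : ℂ)⁻¹ * Matrix.trace (exp ((Complex.I * ((((((ℓ + 1 : ℕ) : ℝ)⁻¹) ^ (K - n) : ℝ)) : ℂ)) • A ⟨p.src, p.μ⟩) * exp ((Complex.I * ((((((ℓ + 1 : ℕ) : ℝ)⁻¹) ^ (K - n) : ℝ)) : ℂ)) • A ⟨p.src.shift p.μ, p.ν⟩) * exp (-((Complex.I * ((((((ℓ + 1 : ℕ) : ℝ)⁻¹) ^ (K - n) : ℝ)) : ℂ)) • A ⟨p.src.shift p.ν, p.μ⟩)) * exp (-((Complex.I * ((((((ℓ + 1 : ℕ) : ℝ)⁻¹) ^ (K - n) : ℝ)) : ℂ)) • A ⟨p.src, p.ν⟩))) + (2 : ℂ)⁻¹ * Matrix.trace (((Complex.I * ((((((ℓ + 1 : ℕ) : ℝ)⁻¹) ^ (K - n) : ℝ)) :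 ℂ)) • A ⟨p.src, p.μ⟩) + ((Complex.I * ((((((ℓ + 1 : ℕ) : ℝ)⁻¹) ^ (K - n) : ℝ)) : ℂ)) • A ⟨p.src.shift p.μ, p.ν⟩) + (-((Complex.I * ((((((ℓ + 1 : ℕ) : ℝ)⁻¹) ^ (K - n) : ℝ)) : ℂ)) • A ⟨p.src.shift p.ν, p.μ⟩)) + (-((Complex.I * ((((((ℓ + 1 : ℕ) : ℝ)⁻¹) ^ (K - n) : ℝ)) : ℂ)) • A ⟨p.src, p.ν⟩))) + (4 : ℂ)⁻¹ * Matrix.trace ((((Complex.I * ((((((ℓ + 1 : ℕ) : ℝ)⁻¹) ^ (K - n) : ℝ)) : ℂ)) • A ⟨p.src, p.μ⟩) + ((Complex.I * ((((((ℓ + 1 : ℕ) : ℝ)⁻¹) ^ (K - n) : ℝ)) : ℂ)) • A ⟨p.src.shift p.μ, p.ν⟩) + (-((Complex.I * ((((((ℓ + 1 : ℕ) : ℝ)⁻¹) ^ (K - n) : ℝ)) : ℂ)) • A ⟨p.src.shift p.ν, p.μ⟩)) + (-((Complex.I * ((((((ℓ + 1 : ℕ) : ℝ)⁻¹) ^ (K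 - n) : ℝ)) : ℂ)) • A ⟨p.src, p.ν⟩))) ^ 2)))) A δ =
        (((((ℓ + 1 : ℕ) : ℝ)⁻¹) ^ (K - n) : ℝ) : ℂ) ^ 4 * ∑ b : PBond (PV 2 ℓ m K hd3 hL) 0, Matrix.trace (W₀ A b * δ b)) ∧
      Differentiable ℂ W₀ ∧
      ∀ E : (PBond (PV 2 ℓ m K hd3 hL) 0 → Matrix (Fin 2) (Fin 2) ℂ) → (PBond (PV 2 ℓ m K hd3 hL) 0 → Matrix (Fin 2) (Fin 2) ℂ),
        (∀ (Y : PBond (PV 2 ℓ m K hd3 hL) 0 → Matrix (Fin 2) (Fin 2) ℂ) (b : PBond (PV 2 ℓ m K hd3 hL) 0) (i j : Fin 2), E Y b i j = (((((((ℓ + 1 : ℕ) : ℝ)⁻¹) ^ (K - n)) : ℝ) : ℂ) ^ 4)⁻¹ *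
          (-((((((((ℓ + 1 : ℕ) : ℝ)⁻¹) ^ (K - n)) : ℝ) : ℂ) ^ 2 / 2) * ∑ p : Plaq (PV 2 ℓ m K hd3 hL) 0, Matrix.trace ((Hs (Dsel Y) ⟨p.src, p.μ⟩ + Hs (Dsel Y) ⟨p.src.shift p.μ, p.ν⟩ - Hs (Dsel Y) ⟨p.src.shift p.ν, p.μ⟩ - Hs (Dsel Y) ⟨p.src, p.ν⟩) *
              (((Pi.single b (Matrix.single j i (1 : ℂ)) : PBond (PV 2 ℓ m K hd3 hL) 0 → Matrix (Fin 2) (Fin 2) ℂ)) ⟨p.src, p.μ⟩ + ((Pi.single b (Matrix.single j i (1 : ℂ)) : PBond (PV 2 ℓ m K hd3 hL) 0 → Matrix (Fin 2) (Fin 2) ℂ)) ⟨p.src.shift p.μ, p.ν⟩ -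
                ((Pi.single b (Matrix.single j i (1 : ℂ)) : PBond (PV 2 ℓ m K hd3 hL) 0 → Matrix (Fin 2) (Fin 2) ℂ)) ⟨p.src.shift p.ν, p.μ⟩ - ((Pi.single b (Matrix.single j i (1 : ℂ)) : PBond (PV 2 ℓ m K hd3 hL) 0 → Matrix (Fin 2) (Fin 2) ℂ)) ⟨p.src, p.ν⟩)))
            - (((((((ℓ + 1 : ℕ) : ℝ)⁻¹) ^ (K - n)) : ℝ) : ℂ) ^ 2 / 2) * ∑ p : Plaq (PV 2 ℓ m K hd3 hL) 0, Matrix.trace (((Y - Hs (Dsel Y)) ⟨p.src, p.μ⟩ + (Y - Hs (Dsel Y)) ⟨p.src.shift p.μ, p.ν⟩ - (Y - Hs (Dsel Y)) ⟨p.src.shift p.ν, p.μ⟩ - (Y - Hs (Dsel Y)) ⟨p.src, p.ν⟩) *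
              (Hs (fderiv ℂ Dsel Y (Pi.single b (Matrix.single j i (1 : ℂ)))) ⟨p.src, p.μ⟩ + Hs (fderiv ℂ Dsel Y (Pi.single b (Matrix.single j i (1 : ℂ)))) ⟨p.src.shift p.μ, p.ν⟩ -
                Hs (fderiv ℂ Dsel Y (Pi.single b (Matrix.single j i (1 : ℂ)))) ⟨p.src.shift p.ν, p.μ⟩ - Hs (fderiv ℂ Dsel Y (Pi.single b (Matrix.single j i (1 : ℂ)))) ⟨p.src, p.ν⟩))
            - ((((((ℓ + 1 : ℕ) : ℝ)⁻¹) ^ (K - n)) : ℝ) : ℂ) ^ 4 * ∑ b' : PBond (PV 2 ℓ m K hd3 hL) 0, Matrix.trace (W₀ (Y - Hs (Dsel Y)) b' * Hs (fderiv ℂ Dsel Y (Pi.single b (Matrix.single j i (1 : ℂ)))) b'))) →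
        ∀ (Y : PBond (PV 2 ℓ m K hd3 hL) 0 → Matrix (Fin 2) (Fin 2) ℂ) (r : ℝ), r < a₃ → (∀ b, w 1 b * ‖Y b‖ ≤ r) →
          (∀ (b : PBond (PV 2 ℓ m K hd3 hL) 0) (ν : Fin 3), w 2 b * ((ℓ + 1 : ℕ) : ℝ) ^ (K - n) * ‖Y ⟨b.src.shift ν, b.dir⟩ - Y b‖ ≤ r) →
          ∀ b, w 3 b * ‖(W₀ (Y - Hs (Dsel Y)) + E Y) b‖ ≤
            (12 * (((ℓ + 1 : ℕ) : ℝ) ^ 3 * (1428 + ((ℓ + 1 : ℕ) : ℝ))) * (1 + 4 * BH * (64 * ((ℓ + 1 : ℕ) : ℝ) / (16 * 3800 * (((((PV 2 ℓ m K hd3 hL)).d + 2) * ((PV 2 ℓ m K hd3 hL)).L : ℕ) : ℝ) ^ 2 * ((ℓ + 1 : ℕ) : ℝ))⁻¹) * Rc₀) ^ 2 +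
              (2 * CX * (64 * ((ℓ + 1 : ℕ) : ℝ) / (16 * 3800 * (((((PV 2 ℓ m K hd3 hL)).d + 2) * ((PV 2 ℓ m K hd3 hL)).L : ℕ) : ℝ) ^ 2 * ((ℓ + 1 : ℕ) : ℝ))⁻¹) + 2⁻¹ * (8 * (7 * (9830400000 * ((ℓ + 1 : ℕ) : ℝ) ^ 4) * (1 + 4 * BH * (64 * ((ℓ + 1 : ℕ) : ℝ) / (16 * 3800 * (((((PV 2 ℓ m K hd3 hL)).d + 2) * ((PV 2 ℓ m K hd3 hL)).L : ℕ) : ℝ) ^ 2 * ((ℓ + 1 : ℕ) : ℝ))⁻¹) * ε)) * (2 * CP)) * (1 + 4 * BH * (64 * ((ℓ + 1 : ℕ) : ℝ) / (16 * 3800 * (((((PV 2 ℓ m K hd3 hL)).d + 2) * ((PV 2 ℓ m K hd3 hL)).L : ℕ) : ℝ) ^ 2 * ((ℓ + 1 : ℕ) : ℝ))⁻¹) * Rc₀) +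
                (16 * K₀ * (7 * (9830400000 * ((ℓ + 1 : ℕ) : ℝ) ^ 4) * (1 + 4 * BH * (64 * ((ℓ + 1 : ℕ) : ℝ) / (16 * 3800 * (((((PV 2 ℓ m K hd3 hL)).d + 2) * ((PV 2 ℓ m K hd3 hL)).L : ℕ) : ℝ) ^ 2 * ((ℓ + 1 : ℕ) : ℝ))⁻¹) * ε))) * Rc₀ * (12 * (((ℓ + 1 : ℕ) : ℝ) ^ 3 * (1428 + ((ℓ + 1 : ℕ) : ℝ)))) * (1 + 4 * BH * (64 * ((ℓ + 1 : ℕ) : ℝ) / (16 * 3800 * (((((PV 2 ℓ m K hd3 hL)).d + 2) * ((PV 2 ℓ m K hd3 hL)).L : ℕ) : ℝ) ^ 2 * ((ℓ + 1 : ℕ) : ℝ))⁻¹) * Rc₀) ^ 2)) * r ^ 2 := by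

  obtain ⟨Mh₀, R₀, BH, CX, K₀, CP, hBH, hCX, hK₀, hCP, hE⟩ := exists_hWq_dressed_cubeSeq_T3_chartOfRecord_ofKernelRow ℓ hL hℓ
  have hC₃ : (0 : ℝ) ≤ 9830400000 * ((ℓ + 1 : ℕ) : ℝ) ^ 4 := by positivity
  have hR'0 : (0 : ℝ) < (29491200000 * ((ℓ + 1 : ℕ) : ℝ) ^ 4)⁻¹ := by positivity
  obtain ⟨ε, Rc₀, a₃, ha₃, ha₃R, hRcε, h3ε, hq, hR', hθ, hall⟩ :=
    hE (9830400000 * ((ℓ + 1 : ℕ) : ℝ) ^ 4) ((29491200000 * ((ℓ + 1 : ℕ) : ℝ) ^ 4)⁻¹) hC₃ hR'0 (radFlat_le_quarter_Rs ℓ)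
  refine ⟨Mh₀, max R₀ 2, BH, CX, K₀, CP, hBH, hCX, hK₀, hCP, ε, Rc₀, a₃, ha₃, ha₃R, hRcε, h3ε, hq, hR', hθ, ?_⟩
  intro m hm n K hk1 hk' Mh R a' hMha hMh hR hsize x₀ ρ S hM hRS w hw
  have hR₀ : R₀ ≤ R := le_trans (le_max_left _ _) hR
  have hR2 : 2 ≤ R := le_trans (le_max_right _ _) hR
  have hAdm : Adm22 (cubeSeqMT3 (⟨ℓ + 1, hL, m, hm⟩ : T3Family) n K x₀ ρ S ((ℓ + 1) * Mh) hM) R ((ℓ + 1) * Mh) :=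
    adm22_cubeSeqMT3 (⟨ℓ + 1, hL, m, hm⟩ : T3Family) n K x₀ ρ hM hRS
  have hDk : (cubeSeqMT3 (⟨ℓ + 1, hL, m, hm⟩ : T3Family) n K x₀ ρ S ((ℓ + 1) * Mh) hM).k = K - n :=
    cubeSeqMT3_k (⟨ℓ + 1, hL, m, hm⟩ : T3Family) n K x₀ ρ S ((ℓ + 1) * Mh) hM
  have hRM : 2 * ((⟨ℓ + 1, hL, m, hm⟩ : T3Family).P K).L ≤ R * ((ℓ + 1) * Mh) + 1 := by
    show 2 * (ℓ + 1) ≤ R * ((ℓ + 1) * Mh) + 1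
    have h2 : 2 * ((ℓ + 1) * Mh) ≤ R * ((ℓ + 1) * Mh) := Nat.mul_le_mul_right _ hR2
    have hMh : 1 ≤ Mh := Nat.pos_of_ne_zero fun h => by subst h; simp at hM
    nlinarith
  exact hall m hm n K hk1 hk' hMha hMh hR₀ hsize x₀ ρ S hM hRS w hw
    (kernel157_flat_ball (⟨ℓ + 1, hL, m, hm⟩ : T3Family) n K (cubeSeqMT3 (⟨ℓ + 1, hL, m, hm⟩ : T3Family) n K x₀ ρ S ((ℓ + 1) * Mh) hM) hDk hAdm hRM hw)

end Summit.QuantumFields.YangMills.Theorems.HalvingDressingLetter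

end
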